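import Mathlib
import HarnessLib
import Summits.ValiantsHypothesis.ValiantsHypothesis.Theses.MonotoneRestoration
import Summits.ValiantsHypothesis.ValiantsHypothesis.Theorems.MonotoneRestorationPolylogWidthMonotoneEasyStatus
import Summits.ValiantsHypothesis.ValiantsHypothesis.Theorems.MonotoneRestorationPolylogWidthMonotoneEasyRealParts
import Literature.Computability.AlgebraicComplexity.BurgisserTransferProofs

/-!
# Route MonotoneRestoration — the kill witness `PolylogWidthMonotoneEasy` with arbitrary complex coefficients

Support file for item `stmt-ValiantsHypothesis-17619` (`…Theses.MonotoneRestoration.PolylogWidthMonotoneEasy`).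

* `polylogWidthMonotoneEasy_iff_complexVP`: the item holds iff some matrix-symmetric `VP` family over
  `ℂ` (tree `IsVPFamily`; arbitrary constants, no sign condition, no monotone circuit) separates, for
  every `c` beyond every `N`, two `C^{(log₂ m + c)^c}`-equivalent graphs on `Fin m` — i.e. iff some
  matrix-symmetric `VP` family has counting width `ω(polylog n)` on graphs, a strong positive
  answer to Dwivedi–Pago–Seppelt 2026, Outlook Q3 (do `VP` and `symVP` coincide on matrix-symmetric
  polynomials?). Reductions (`←`): real or imaginary part (`realVP_witness_of_complexVP`, cost
  `6 L + 6`), nonnegative shift `r + (Σ|coeff r|) · (1 + Σ x)^{deg r}` lifted to `ℝ≥0`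
  (`nonnegVP_witness_of_realVP`; the dense part cancels on `C^2`-equivalent graphs), then Hrubeš's
  bridge (`polylogWidthMonotoneEasy_iff_nonnegVP`).
* `not_polylogWidthMonotoneEasy_iff_widthLaw`, `valiantsHypothesis_of_widthLaw`: the negation of
  the item, stated positively, is a MONOTONE POLYLOG-WIDTH LAW, and it alone decides the summit
  (through `valiantsHypothesis_of_not_polylogWidthMonotoneEasy`); the route's crux implies it through
  the glue `WidthKillsRestoration`, so it is a thinner sufficient mechanism than restoration.

No new definitions.
-/

set_option linter.dupNamespace false

namespace Summit.ValiantsHypothesis.ValiantsHypothesis.Theorems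

open Summit.ValiantsHypothesis.ValiantsHypothesis.Theses.MonotoneRestoration
open MvPolynomial Literature.Computability.AlgebraicComplexity
open Literature.ModelTheory.FiniteModelTheory

/-! ### Arithmetic of the exponents -/

/-- Monotonicity of the polylog level in the constant: `(a + c)^c ≤ (a + c')^c'` for `c ≤ c'`.
[folklore] -/
theorem logLevel_mono (a : ℕ) {c c' : ℕ} (h : c ≤ c') : (a + c) ^ c ≤ (a + c') ^ c' := by
  rcases Nat.eq_zero_or_pos c' with h0 | hpos
  · subst h0
    have hc : c = 0 := Nat.le_zero.1 h
    subst hc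
    exact le_rfl
  · calc (a + c) ^ c ≤ (a + c') ^ c := Nat.pow_le_pow_left (by omega) _
      _ ≤ (a + c') ^ c' := Nat.pow_le_pow_right (by omega) h

/-! ### From a real `VP` witness to a nonnegative one -/

/-- `|coeff_m r| ≤ Σ_{m' ∈ supp r} |coeff_{m'} r|`. [folklore] -/
theorem abs_coeff_le_sum_abs {τ : Type*} (r : MvPolynomial τ ℝ) (m : τ →₀ ℕ) :
    |coeff m r| ≤ ∑ m' ∈ r.support, |coeff m' r| := by
  by_cases hm : m ∈ r.support
  · exact Finset.single_le_sum (f := fun m' => |coeff m' r|) (fun _ _ => abs_nonneg _) hm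
  · rw [notMem_support_iff.1 hm, abs_zero]
    exact Finset.sum_nonneg fun _ _ => abs_nonneg _

/-- **Nonnegative shift**: `r + M · (1 + Σ_p x_p)^{deg r}` with `M = Σ |coeff r|` has nonnegative
coefficients (`one_le_coeff_densePow` on the support of `r`, `coeff_densePow_nonneg` elsewhere).
[folklore] -/
theorem coeff_add_denseShift_nonneg {τ : Type*} [Fintype τ] [DecidableEq τ] (r : MvPolynomial τ ℝ)
    (m : τ →₀ ℕ) :
    0 ≤ coeff m (r + C (∑ m' ∈ r.support, |coeff m' r|) *
      (1 + ∑ p : τ, X p : MvPolynomial τ ℝ) ^ r.totalDegree) := by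
  have hM0 : 0 ≤ ∑ m' ∈ r.support, |coeff m' r| := Finset.sum_nonneg fun _ _ => abs_nonneg _
  rw [coeff_add, coeff_C_mul]
  by_cases hm : m ∈ r.support
  · have hdeg : m.degree ≤ r.totalDegree := by
      have h := le_totalDegree hm
      rw [Finsupp.degree_apply]
      exact h
    have h1 := one_le_coeff_densePow r.totalDegree m hdeg
    have h2 := abs_coeff_le_sum_abs r m
    have h3 : -coeff m r ≤ ∑ m' ∈ r.support, |coeff m' r| := (neg_le_abs _).trans h2
    nlinarith [mul_le_mul_of_nonneg_left h1 hM0]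
  · rw [notMem_support_iff.1 hm, zero_add]
    exact mul_nonneg hM0 (coeff_densePow_nonneg _ _)

/-- Total degree of the shifted polynomial: still `deg r`. [folklore] -/
theorem totalDegree_add_denseShift_le {τ : Type*} [Fintype τ] (r : MvPolynomial τ ℝ) (M : ℝ) :
    (r + C M * (1 + ∑ p : τ, X p : MvPolynomial τ ℝ) ^ r.totalDegree).totalDegree ≤ r.totalDegree := by
  have hE : (1 + ∑ p : τ, X p : MvPolynomial τ ℝ).totalDegree ≤ 1 := by
    refine (totalDegree_add _ _).trans (max_le ?_ ?_)
    · rw [totalDegree_one]; exact Nat.zero_le _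
    · refine (totalDegree_finsetSum _ _).trans (Finset.sup_le fun p _ => ?_)
      exact (totalDegree_X (R := ℝ) p).le
  refine (totalDegree_add _ _).trans (max_le le_rfl ?_)
  refine (totalDegree_mul _ _).trans ?_
  rw [totalDegree_C, zero_add]
  refine (totalDegree_pow _ _).trans ?_
  calc r.totalDegree * (1 + ∑ p : τ, X p : MvPolynomial τ ℝ).totalDegree ≤ r.totalDegree * 1 :=
        Nat.mul_le_mul_left _ hE
    _ = r.totalDegree := mul_one _

/-- Cost of the shifted polynomial: `L(r) + deg r · (N + 2) + 2`. [folklore] -/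
theorem complexity_add_denseShift_le {τ : Type*} [Fintype τ] (r : MvPolynomial τ ℝ) (M : ℝ) :
    complexity (r + C M * (1 + ∑ p : τ, X p : MvPolynomial τ ℝ) ^ r.totalDegree) ≤
      complexity r + r.totalDegree * (Fintype.card τ + 2) + 2 := by
  calc _ ≤ complexity r + complexity (C M * (1 + ∑ p : τ, X p : MvPolynomial τ ℝ) ^ r.totalDegree) + 1 :=
        complexity_add_le_holds _ _
    _ ≤ complexity r + (0 + r.totalDegree * (Fintype.card τ + 2) + 1) + 1 := by
        gcongr
        calc _ ≤ complexity (C M : MvPolynomial τ ℝ) +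
              complexity ((1 + ∑ p : τ, X p : MvPolynomial τ ℝ) ^ r.totalDegree) + 1 :=
              complexity_mul_le_holds _ _
          _ ≤ 0 + r.totalDegree * (Fintype.card τ + 2) + 1 := by
              gcongr
              · exact (complexity_C_holds (k := ℝ) (σ := τ) M).le
              · exact complexity_densePow_le _
    _ = complexity r + r.totalDegree * (Fintype.card τ + 2) + 2 := by ring

open Classical in
/-- The real `0/1` adjacency matrix, cast to `ℂ`, is the complex one. [folklore] -/
theorem indicator_adj_eq_ofReal_ite {m : ℕ} (Γ : SimpleGraph (Fin m)) :
    Set.indicator {ij : Fin m × Fin m | Γ.Adj ij.1 ij.2} (1 : Fin m × Fin m → ℂ) =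
      fun ij : Fin m × Fin m => (((if Γ.Adj ij.1 ij.2 then (1 : ℝ) else 0 : ℝ)) : ℂ) := by
  funext ij
  by_cases h : Γ.Adj ij.1 ij.2 <;> simp [h]

open Classical in
/-- **From a real witness to a nonnegative one.** A matrix-symmetric `VP` family over `ℝ` separating
polylog-equivalent graphs yields a matrix-symmetric family over `ℝ≥0` with `VP` complexification
separating polylog-equivalent graphs: shift by `M_n (1 + Σ x)^{deg}` (nonnegative coefficients,
`coeff_add_denseShift_nonneg`; invariant; cost `+ deg · (n² + 2) + 2`), lift to `ℝ≥0`
(`exists_nnreal_of_coeff_nonneg`); the dense part cancels on `C^2`-equivalent graphs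
(`eval_densePart_eq_of_ckEquiv`). [folklore] -/
theorem nonnegVP_witness_of_realVP
    (r : (n : ℕ) → MvPolynomial (Fin n × Fin n) ℝ)
    (hsymm : ∀ (n : ℕ) (σ τ : Equiv.Perm (Fin n)),
      rename (fun p : Fin n × Fin n => (σ p.1, τ p.2)) (r n) = r n)
    (hVP : IsVPFamily r)
    (hsep : ∀ c N : ℕ, ∃ m : ℕ, N ≤ m ∧ ∃ X Y : SimpleGraph (Fin m),
      CkEquiv ((Nat.log 2 m + c) ^ c) X Y ∧
      eval (fun ij : Fin m × Fin m => if X.Adj ij.1 ij.2 then (1 : ℝ) else 0) (r m) ≠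
        eval (fun ij : Fin m × Fin m => if Y.Adj ij.1 ij.2 then (1 : ℝ) else 0) (r m)) :
    ∃ h : (n : ℕ) → MvPolynomial (Fin n × Fin n) NNReal,
      (∀ (n : ℕ) (σ τ : Equiv.Perm (Fin n)),
        rename (fun p : Fin n × Fin n => (σ p.1, τ p.2)) (h n) = h n) ∧
      IsVPFamily (fun n => map (Complex.ofRealHom.comp NNReal.toRealHom) (h n)) ∧
      ∀ c N : ℕ, ∃ m : ℕ, N ≤ m ∧ ∃ X Y : SimpleGraph (Fin m),
        CkEquiv ((Nat.log 2 m + c) ^ c) X Y ∧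
        eval (Set.indicator {ij : Fin m × Fin m | X.Adj ij.1 ij.2} 1)
            (map (Complex.ofRealHom.comp NNReal.toRealHom) (h m)) ≠
          eval (Set.indicator {ij : Fin m × Fin m | Y.Adj ij.1 ij.2} 1)
            (map (Complex.ofRealHom.comp NNReal.toRealHom) (h m)) := by
  -- the shifted family and its lift to `ℝ≥0`
  have hq : ∀ n, ∃ hn : MvPolynomial (Fin n × Fin n) NNReal, map NNReal.toRealHom hn =
      r n + C (∑ m' ∈ (r n).support, |coeff m' (r n)|) *
        (1 + ∑ p : Fin n × Fin n, X p : MvPolynomial (Fin n × Fin n) ℝ) ^ (r n).totalDegree :=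
    fun n => exists_nnreal_of_coeff_nonneg _ (coeff_add_denseShift_nonneg (r n))
  choose h hh using hq
  have hmapmap : ∀ n, map (Complex.ofRealHom.comp NNReal.toRealHom) (h n) =
      map Complex.ofRealHom (map NNReal.toRealHom (h n)) := fun n => (map_map _ _ _).symm
  refine ⟨h, ?_, ?_, ?_⟩
  · -- invariance
    intro n σ τ
    apply map_injective NNReal.toRealHom (by rw [NNReal.coe_toRealHom]; exact NNReal.coe_injective)
    rw [map_rename, hh n, map_add, map_mul, rename_C, hsymm n σ τ]
    congr 2
    have he : (fun p : Fin n × Fin n => (σ p.1, τ p.2)) = ⇑(Equiv.prodCongr σ τ) := by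
      funext p; rfl
    rw [he]
    exact rename_densePow (Equiv.prodCongr σ τ) _
  · -- `VP`
    obtain ⟨⟨-, c₁, hc₁⟩, c₂, hc₂⟩ := hVP
    refine ⟨⟨⟨2, fun n => ?_⟩, ⟨c₁, fun n => ?_⟩⟩,
      ⟨2 * (c₁ + c₂ + 6) + 3 ^ (c₁ + c₂ + 6), fun n => ?_⟩⟩
    · simp only [Fintype.card_prod, Fintype.card_fin]
      nlinarith
    · show (map (Complex.ofRealHom.comp NNReal.toRealHom) (h n)).totalDegree ≤ n ^ c₁ + c₁
      rw [hmapmap n, hh n]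
      refine (Finset.sup_mono (support_map_subset _ _)).trans ?_
      exact (totalDegree_add_denseShift_le _ _).trans (hc₁ n)
    · show complexity (map (Complex.ofRealHom.comp NNReal.toRealHom) (h n)) ≤ _
      rw [hmapmap n, hh n]
      refine (ArithCircuit.complexity_map_le _ _).trans ?_
      refine (complexity_add_denseShift_le _ _).trans ?_
      refine le_trans ?_ (targetImpliesCrux_pow_bound n (c₁ + c₂ + 6))
      have h1 : complexity (r n) ≤ (n + 2) ^ (c₂ + 1) := (hc₂ n).trans (pow_add_le_add_two_pow n c₂)
      have h2 : (r n).totalDegree ≤ (n + 2) ^ (c₁ + 1) :=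
        ((hc₁ n).trans (pow_add_le_add_two_pow n c₁))
      have h3 : Fintype.card (Fin n × Fin n) + 2 ≤ (n + 2) ^ 2 := by
        simp only [Fintype.card_prod, Fintype.card_fin]
        nlinarith
      have hp : ∀ {a b : ℕ}, a ≤ b → (n + 2) ^ a ≤ (n + 2) ^ b := fun hab =>
        Nat.pow_le_pow_right (by omega) hab
      have h4 : 2 ≤ (n + 2) ^ 1 := by rw [pow_one]; omega
      calc complexity (r n) + (r n).totalDegree * (Fintype.card (Fin n × Fin n) + 2) + 2
          ≤ (n + 2) ^ (c₂ + 1) + (n + 2) ^ (c₁ + 1) * (n + 2) ^ 2 + (n + 2) ^ 1 :=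
            Nat.add_le_add (Nat.add_le_add h1 (Nat.mul_le_mul h2 h3)) h4
        _ = (n + 2) ^ (c₂ + 1) + (n + 2) ^ (c₁ + 3) + (n + 2) ^ 1 := by ring
        _ ≤ (n + 2) ^ (c₁ + c₂ + 4) + (n + 2) ^ (c₁ + c₂ + 4) + (n + 2) ^ (c₁ + c₂ + 4) := by
            gcongr <;> omega
        _ = 3 * (n + 2) ^ (c₁ + c₂ + 4) := by ring
        _ ≤ (n + 2) ^ 2 * (n + 2) ^ (c₁ + c₂ + 4) := Nat.mul_le_mul_right _ (by nlinarith)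
        _ = (n + 2) ^ (c₁ + c₂ + 6) := by ring
  · -- separation
    intro c N
    obtain ⟨m, hNm, X, Y, hXY, hne⟩ := hsep (c + 2) N
    have hlevel2 : 2 ≤ (Nat.log 2 m + (c + 2)) ^ (c + 2) :=
      calc 2 ≤ Nat.log 2 m + (c + 2) := by omega
        _ ≤ (Nat.log 2 m + (c + 2)) ^ (c + 2) := Nat.le_self_pow (by omega) _
    refine ⟨m, hNm, X, Y, hXY.mono (logLevel_mono _ (by omega)), ?_⟩
    have h2 : CkEquiv 2 X Y := hXY.mono hlevel2
    have hdense := eval_densePart_eq_of_ckEquiv h2 le_rfl ℝ (r m).totalDegree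
    rw [indicator_adj_eq_ofReal_ite X, indicator_adj_eq_ofReal_ite Y, hmapmap m, hh m,
      eval_ofReal_map, eval_ofReal_map]
    intro heq
    apply hne
    have heq' := Complex.ofReal_injective heq
    simp only [map_add, map_mul, eval_C] at heq'
    rw [hdense] at heq'
    exact add_right_cancel heq'

/-! ### From a complex `VP` witness to a real one -/

open Classical in
/-- **From a complex witness to a real one.** If a matrix-symmetric `VP` family over `ℂ` separates
polylog-equivalent graphs, then so does its coefficientwise real part or its coefficientwise
imaginary part (both matrix-symmetric `VP` families over `ℝ`: `exists_realPart_complexity_le`,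
`rename_realParts`, `totalDegree_realParts_le`). [folklore] -/
theorem realVP_witness_of_complexVP
    (p : (n : ℕ) → MvPolynomial (Fin n × Fin n) ℂ)
    (hsymm : ∀ (n : ℕ) (σ τ : Equiv.Perm (Fin n)),
      rename (fun q : Fin n × Fin n => (σ q.1, τ q.2)) (p n) = p n)
    (hVP : IsVPFamily p)
    (hsep : ∀ c N : ℕ, ∃ m : ℕ, N ≤ m ∧ ∃ X Y : SimpleGraph (Fin m),
      CkEquiv ((Nat.log 2 m + c) ^ c) X Y ∧
      eval (Set.indicator {ij : Fin m × Fin m | X.Adj ij.1 ij.2} 1) (p m) ≠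
        eval (Set.indicator {ij : Fin m × Fin m | Y.Adj ij.1 ij.2} 1) (p m)) :
    ∃ r : (n : ℕ) → MvPolynomial (Fin n × Fin n) ℝ,
      (∀ (n : ℕ) (σ τ : Equiv.Perm (Fin n)),
        rename (fun q : Fin n × Fin n => (σ q.1, τ q.2)) (r n) = r n) ∧
      IsVPFamily r ∧
      ∀ c N : ℕ, ∃ m : ℕ, N ≤ m ∧ ∃ X Y : SimpleGraph (Fin m),
        CkEquiv ((Nat.log 2 m + c) ^ c) X Y ∧
        eval (fun ij : Fin m × Fin m => if X.Adj ij.1 ij.2 then (1 : ℝ) else 0) (r m) ≠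
          eval (fun ij : Fin m × Fin m => if Y.Adj ij.1 ij.2 then (1 : ℝ) else 0) (r m) := by
  -- real and imaginary parts, with their costs
  choose x y hxy hcx using fun n => RealForms.exists_realPart_complexity_le (p n)
  choose u v huv hcu using fun n => RealForms.exists_realPart_complexity_le (C (-Complex.I) * p n)
  have huy : ∀ n, u n = y n := fun n =>
    (realParts_unique (by rw [← huv n, hxy n, negI_mul_decomp])).1
  have hcy : ∀ n, complexity (y n) ≤ 6 * (complexity (p n) + 1) := fun n => by
    rw [← huy n]
    refine (hcu n).trans ?_
    gcongr
    rw [C_mul']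
    exact complexity_smul_le_holds _ _
  have hsx : ∀ (n : ℕ) (σ τ : Equiv.Perm (Fin n)),
      rename (fun q : Fin n × Fin n => (σ q.1, τ q.2)) (x n) = x n ∧
      rename (fun q : Fin n × Fin n => (σ q.1, τ q.2)) (y n) = y n :=
    fun n σ τ => rename_realParts _ (hxy n) (hsymm n σ τ)
  obtain ⟨⟨-, c₁, hc₁⟩, c₂, hc₂⟩ := hVP
  have hdeg : ∀ n, (x n).totalDegree ≤ n ^ c₁ + c₁ ∧ (y n).totalDegree ≤ n ^ c₁ + c₁ := by
    intro n
    have h := totalDegree_realParts_le (x n) (y n)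
    rw [← hxy n] at h
    exact ⟨h.1.trans (hc₁ n), h.2.trans (hc₁ n)⟩
  have hcard : IsPBounded fun n => Fintype.card (Fin n × Fin n) := ⟨2, fun n => by
    simp only [Fintype.card_prod, Fintype.card_fin]
    nlinarith⟩
  have hVPx : IsVPFamily x := by
    refine ⟨⟨hcard, c₁, fun n => (hdeg n).1⟩, ⟨2 * (c₂ + 4) + 3 ^ (c₂ + 4), fun n => ?_⟩⟩
    refine (hcx n).trans (le_trans ?_ (targetImpliesCrux_pow_bound n (c₂ + 4)))
    calc 6 * complexity (p n) ≤ (n + 2) ^ 3 * (n + 2) ^ (c₂ + 1) := by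
          refine Nat.mul_le_mul ?_ ((hc₂ n).trans (pow_add_le_add_two_pow n c₂))
          calc 6 ≤ 2 ^ 3 := by norm_num
            _ ≤ (n + 2) ^ 3 := Nat.pow_le_pow_left (by omega) 3
      _ = (n + 2) ^ (c₂ + 4) := by ring
  have hVPy : IsVPFamily y := by
    refine ⟨⟨hcard, c₁, fun n => (hdeg n).2⟩, ⟨2 * (c₂ + 5) + 3 ^ (c₂ + 5), fun n => ?_⟩⟩
    refine (hcy n).trans (le_trans ?_ (targetImpliesCrux_pow_bound n (c₂ + 5)))
    calc 6 * (complexity (p n) + 1) ≤ (n + 2) ^ 3 * ((n + 2) ^ (c₂ + 1) + (n + 2) ^ (c₂ + 1)) := by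
          refine Nat.mul_le_mul ?_ (Nat.add_le_add ((hc₂ n).trans (pow_add_le_add_two_pow n c₂)) ?_)
          · calc 6 ≤ 2 ^ 3 := by norm_num
              _ ≤ (n + 2) ^ 3 := Nat.pow_le_pow_left (by omega) 3
          · exact Nat.one_le_pow _ _ (by omega)
      _ = 2 * (n + 2) ^ (c₂ + 4) := by ring
      _ ≤ (n + 2) * (n + 2) ^ (c₂ + 4) := Nat.mul_le_mul_right _ (by omega)
      _ = (n + 2) ^ (c₂ + 5) := by ring
  -- one of the two parts separates polylog-equivalent graphs
  have key : (∀ c N : ℕ, ∃ m : ℕ, N ≤ m ∧ ∃ X Y : SimpleGraph (Fin m),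
      CkEquiv ((Nat.log 2 m + c) ^ c) X Y ∧
      eval (fun ij : Fin m × Fin m => if X.Adj ij.1 ij.2 then (1 : ℝ) else 0) (x m) ≠
        eval (fun ij : Fin m × Fin m => if Y.Adj ij.1 ij.2 then (1 : ℝ) else 0) (x m)) ∨
      (∀ c N : ℕ, ∃ m : ℕ, N ≤ m ∧ ∃ X Y : SimpleGraph (Fin m),
      CkEquiv ((Nat.log 2 m + c) ^ c) X Y ∧
      eval (fun ij : Fin m × Fin m => if X.Adj ij.1 ij.2 then (1 : ℝ) else 0) (y m) ≠
        eval (fun ij : Fin m × Fin m => if Y.Adj ij.1 ij.2 then (1 : ℝ) else 0) (y m)) := by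
    by_contra hcon
    push Not at hcon
    obtain ⟨⟨c₃, N₃, h₃⟩, ⟨c₄, N₄, h₄⟩⟩ := hcon
    obtain ⟨m, hNm, X, Y, hXY, hne⟩ := hsep (max c₃ c₄) (max N₃ N₄)
    have hX3 : CkEquiv ((Nat.log 2 m + c₃) ^ c₃) X Y := hXY.mono (logLevel_mono _ (le_max_left _ _))
    have hX4 : CkEquiv ((Nat.log 2 m + c₄) ^ c₄) X Y := hXY.mono (logLevel_mono _ (le_max_right _ _))
    have e3 := h₃ m ((le_max_left _ _).trans hNm) X Y hX3
    have e4 := h₄ m ((le_max_right _ _).trans hNm) X Y hX4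
    apply hne
    rw [indicator_adj_eq_ofReal_ite X, indicator_adj_eq_ofReal_ite Y, hxy m, eval_ofReal_decomp,
      eval_ofReal_decomp, e3, e4]
  rcases key with hx | hy
  · exact ⟨x, fun n σ τ => (hsx n σ τ).1, hVPx, hx⟩
  · exact ⟨y, fun n σ τ => (hsx n σ τ).2, hVPy, hy⟩

/-! ### The witness with arbitrary complex coefficients -/

/-- **Neither monotonicity nor nonnegativity matters for the kill witness.** The item
`PolylogWidthMonotoneEasy` holds iff some matrix-symmetric `VP` family over `ℂ` (tree `IsVPFamily`,
arbitrary complex constants and signs) separates, for every `c` beyond every `N`, two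
`C^{(log₂ m + c)^c}`-equivalent graphs on `Fin m`, i.e. iff some matrix-symmetric `VP` family has
counting width `ω(polylog n)` on graphs — a strong positive answer to Dwivedi–Pago–Seppelt 2026,
Outlook Q3 (`VP ∩ matrix-symmetric ⊄ symVP`). (`→`: complexify; `←`: real or imaginary part,
nonnegative shift by `M (1 + Σ x)^d`, Hrubeš's bridge.) [cite: DwivediPagoSeppelt2026, Outlook Q3]
[cite: Hrubes2020, Thm 1] -/
theorem polylogWidthMonotoneEasy_iff_complexVP :
    PolylogWidthMonotoneEasy ↔
      ∃ p : (n : ℕ) → MvPolynomial (Fin n × Fin n) ℂ,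
        (∀ (n : ℕ) (σ τ : Equiv.Perm (Fin n)),
          rename (fun q : Fin n × Fin n => (σ q.1, τ q.2)) (p n) = p n) ∧
        IsVPFamily p ∧
        ∀ c N : ℕ, ∃ m : ℕ, N ≤ m ∧ ∃ X Y : SimpleGraph (Fin m),
          CkEquiv ((Nat.log 2 m + c) ^ c) X Y ∧
          eval (Set.indicator {ij : Fin m × Fin m | X.Adj ij.1 ij.2} 1) (p m) ≠
            eval (Set.indicator {ij : Fin m × Fin m | Y.Adj ij.1 ij.2} 1) (p m) := by
  rw [polylogWidthMonotoneEasy_iff_nonnegVP]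
  constructor
  · rintro ⟨h, hsymm, hVP, hsep⟩
    refine ⟨fun n => map (Complex.ofRealHom.comp NNReal.toRealHom) (h n), fun n σ τ => ?_, hVP, hsep⟩
    show rename _ (map _ (h n)) = map _ (h n)
    rw [← map_rename, hsymm n σ τ]
  · rintro ⟨p, hsymm, hVP, hsep⟩
    classical
    obtain ⟨r, hrsymm, hrVP, hrsep⟩ := realVP_witness_of_complexVP p hsymm hVP hsep
    exact nonnegVP_witness_of_realVP r hrsymm hrVP hrsep

/-! ### The negation, positively: the monotone polylog-width law -/

/-- **The negation of the kill witness is a WIDTH LAW**, stated positively: every matrix-symmetric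
family over `ℝ≥0` of polynomial degree and polynomial monotone complexity has, eventually, equal
values on `C^{(log₂ m + c)^c}`-equivalent graphs (polylogarithmic counting width on graphs). By
`valiantsHypothesis_of_not_polylogWidthMonotoneEasy` this law alone implies `VP_ℂ ≠ VNP_ℂ`, and by the
route's glue `WidthKillsRestoration` it follows from the crux `MonotoneRestorationQP`; it is therefore
a thinner sufficient mechanism for the route than restoration itself. [folklore] -/
theorem not_polylogWidthMonotoneEasy_iff_widthLaw :
    ¬ PolylogWidthMonotoneEasy ↔
      ∀ f : (n : ℕ) → MvPolynomial (Fin n × Fin n) NNReal,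
        (∀ (n : ℕ) (σ τ : Equiv.Perm (Fin n)),
          rename (fun p : Fin n × Fin n => (σ p.1, τ p.2)) (f n) = f n) →
        (∃ c : ℕ, ∀ n : ℕ, (f n).totalDegree ≤ (n + 2) ^ c ∧
          complexity (k := NNReal) (f n) ≤ (n + 2) ^ c) →
        ∃ c N : ℕ, ∀ m : ℕ, N ≤ m → ∀ X Y : SimpleGraph (Fin m),
          CkEquiv ((Nat.log 2 m + c) ^ c) X Y →
          eval (Set.indicator {ij : Fin m × Fin m | X.Adj ij.1 ij.2} 1)
              (map (Complex.ofRealHom.comp NNReal.toRealHom) (f m)) =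
            eval (Set.indicator {ij : Fin m × Fin m | Y.Adj ij.1 ij.2} 1)
              (map (Complex.ofRealHom.comp NNReal.toRealHom) (f m)) := by
  unfold PolylogWidthMonotoneEasy
  constructor
  · intro h f hsymm hc
    by_contra hcon
    push Not at hcon
    exact h ⟨f, hsymm, hc, hcon⟩
  · rintro h ⟨f, hsymm, hc, hsep⟩
    obtain ⟨c, N, hcN⟩ := h f hsymm hc
    obtain ⟨m, hNm, X, Y, hXY, hne⟩ := hsep c N
    exact hne (hcN m hNm X Y hXY)

/-- **The width law decides the summit** (re-gluing hint for planners): the positive width law of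
`not_polylogWidthMonotoneEasy_iff_widthLaw` implies `VP_ℂ ≠ VNP_ℂ`. [folklore] -/
theorem valiantsHypothesis_of_widthLaw
    (h : ∀ f : (n : ℕ) → MvPolynomial (Fin n × Fin n) NNReal,
        (∀ (n : ℕ) (σ τ : Equiv.Perm (Fin n)),
          rename (fun p : Fin n × Fin n => (σ p.1, τ p.2)) (f n) = f n) →
        (∃ c : ℕ, ∀ n : ℕ, (f n).totalDegree ≤ (n + 2) ^ c ∧
          complexity (k := NNReal) (f n) ≤ (n + 2) ^ c) →
        ∃ c N : ℕ, ∀ m : ℕ, N ≤ m → ∀ X Y : SimpleGraph (Fin m),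
          CkEquiv ((Nat.log 2 m + c) ^ c) X Y →
          eval (Set.indicator {ij : Fin m × Fin m | X.Adj ij.1 ij.2} 1)
              (map (Complex.ofRealHom.comp NNReal.toRealHom) (f m)) =
            eval (Set.indicator {ij : Fin m × Fin m | Y.Adj ij.1 ij.2} 1)
              (map (Complex.ofRealHom.comp NNReal.toRealHom) (f m))) :
    _root_.ValiantsHypothesis :=
  valiantsHypothesis_of_not_polylogWidthMonotoneEasy (not_polylogWidthMonotoneEasy_iff_widthLaw.2 h)

end Summit.ValiantsHypothesis.ValiantsHypothesis.Theorems
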